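import Summits.NavierStokesRegularity.NavierStokesRegularity.Theorems.EulerZoomLiouvillePowerGaugeEulerLiouvilleBreatherProfile
import Summits.NavierStokesRegularity.NavierStokesRegularity.Theorems.EulerZoomLiouvillePowerGaugeEulerLiouvilleSelfSimilarPastProfileDissipation
import Summits.NavierStokesRegularity.NavierStokesRegularity.Theorems.EulerZoomLiouvillePowerGaugeEulerLiouvilleSelfSimilarPastProfileGradient
import Literature.Analysis.FluidPDE.WholeSpaceIBP

/-!
# Crux `EulerZoomLiouville.PowerGaugeEulerLiouville` (stmt-NavierStokesRegularity-19832), line `logtime-breathers` (T2/T3):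
# profile data of a CLASSICAL log-time breather — profile equation, `A`-growth, the weak gradient in profile variables, `E`-growth

Width seat `ns-ezl-w4` (breather rigidity, file IV: the weak gradient in profile variables and its `E`-growth; sequel of `…BreatherProfile`).  A classical Euler pair `(u, p)` on `(−∞,0) × ℝ³` with
`u(τ, y) = e^{cτ} V(e^{−cτ} y)` for all `τ < 0` (any real `c`) has, in the profile variable `z = e^{−cτ} y`:

* `profile_eq`, `contDiff_profile`, `isDivFree_profile` — `V = e^{−cτ} u(τ, e^{cτ}·)` is smooth and divergence free;
* `profile_equation` — for EVERY `τ < 0`: `c V − c (z·∇)V + (V·∇)V + ∇P_τ = 0` with the slice pressure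
  `P_τ(z) = e^{−2cτ} p(τ, e^{cτ} z)` (`ClockRigidity.profile_identity` with `θ = ℓ = e^{cτ}`): the generalised profile equation
  `(α, β) = (c, −c)` of `ClassicalProfile.*`;
* `lintegral_ball_profile_le` — the `A`-gauge `a^{2ρ} A(a) ≤ c₀` (`ρ ≥ 0`) gives `∫_{B_L}|V|² ≤ e^{(4+2ρ)|c|} c₀ L^{1−2ρ}` for ALL `L > 0`
  (slices `τ → 0⁻`);
* `ae_slice_gradient_eq` — a weak spatial gradient `H` of `u` on the slab is `∇V(e^{−cτ}·)` a.e., for a.e. `τ < 0`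
  (slices of weak gradients + uniqueness `HasWeakFDerivOn.unique_holds` against the classical gradient);
* `profile_gradient_growth_of_gaugeE` — the `E`-gauge `a^{ρ} E(a) ≤ c₀` gives `∫_{B_L}|∇V|²_F ≤ C L^{1−ρ}` for `L ≥ 2`
  (window `(−2,−1) × B_a ⊆ Q_a`, `a = e^{2|c|} L`, Tonelli, slice dilation; the template is
  `Past.profile_gradient_growth_of_gaugeE_past`).

WHAT THIS IS NOT: not NS regularity, not the crux — data bricks for the breather-rigidity member; `--supports` stmt-19832. [folklore]
-/

noncomputable section

set_option linter.dupNamespace false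

open MeasureTheory Set Filter Topology Metric Function TopologicalSpace
open scoped ENNReal NNReal RealInnerProductSpace ContDiff

namespace Summit.NavierStokesRegularity.NavierStokesRegularity.Theorems.PowerGaugeEulerLiouville

open Literature.Analysis Literature.Analysis.FunctionSpaces Literature.Analysis.FluidPDE

namespace BreatherRigidity

variable {u : ℝ → EuclideanSpace ℝ (Fin 3) → EuclideanSpace ℝ (Fin 3)} {p : ℝ → EuclideanSpace ℝ (Fin 3) → ℝ}
  {H : ℝ → EuclideanSpace ℝ (Fin 3) → EuclideanSpace ℝ (Fin 3) →L[ℝ] EuclideanSpace ℝ (Fin 3)}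
  {c : ℝ} {V : EuclideanSpace ℝ (Fin 3) → EuclideanSpace ℝ (Fin 3)}

/-! ### The weak gradient in profile variables -/

/-- **Slices of the weak gradient of a classical breather.**  If `H` is a weak spatial gradient of `u` on the slab
`(−∞,0) × ℝ³` and `u(τ, y) = e^{cτ} V(e^{−cτ} y)` classically, then for a.e. `τ < 0`: `H(τ) = ∇V(e^{−cτ}·)` a.e. on `ℝ³`
(a.e. slice of `H` is a weak derivative of the `C¹` slice `u(τ)` — `ae_hasWeakFDerivOn_slice_slab` — whose classical derivative
`∇V(e^{−cτ}·)` is one too; uniqueness of weak derivatives). [folklore] -/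
theorem ae_slice_gradient_eq
    (hH : HasWeakSpatialGradientOn (slab (EuclideanSpace ℝ (Fin 3)) (Iio 0) isOpen_Iio) u H)
    (hcl : IsClassicalEulerSolutionOn (Iio 0) 0 u p)
    (hbr : ∀ τ : ℝ, τ < 0 → ∀ y, u τ y = Real.exp (c * τ) • V (Real.exp (-(c * τ)) • y)) :
    ∀ᵐ τ ∂((volume : Measure ℝ).restrict (Iio (0 : ℝ))),
      H τ =ᵐ[volume] fun x => fderiv ℝ V (Real.exp (-(c * τ)) • x) := by
  have hVd : Differentiable ℝ V := (contDiff_profile hcl hbr).differentiable (by simp)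
  -- a.e. slice below `0` is a weak derivative on `ℝ³` (adapted from `Past.exists_profileGradient_ae_of_past`)
  have hslice0 : ∀ᵐ τ ∂((volume : Measure ℝ).restrict (Iio (0 : ℝ))),
      HasWeakFDerivOn (⊤ : Opens (EuclideanSpace ℝ (Fin 3))) volume (u τ) (H τ) := by
    have hU : (Iio (0 : ℝ)) = ⋃ n : ℕ, Ioo (-((n : ℝ) + 1)) 0 := by
      refine subset_antisymm (fun t ht => mem_iUnion.2 ?_) (iUnion_subset fun n t ht => ht.2)
      obtain ⟨n, hn⟩ := exists_nat_gt (-t)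
      exact ⟨n, ⟨by linarith, ht⟩⟩
    rw [hU, ae_restrict_iUnion_iff]
    intro n
    have hn : HasWeakSpatialGradientOn
        (slab (EuclideanSpace ℝ (Fin 3)) (Ioo (-((n : ℝ) + 1)) 0) isOpen_Ioo) u H :=
      hH.mono (slab_mono Ioo_subset_Iio_self)
    exact hn.ae_hasWeakFDerivOn_slice_slab
  filter_upwards [hslice0, ae_restrict_mem measurableSet_Iio] with τ hW hτ
  have hτ' : τ < 0 := hτ
  have hC1 : ContDiff ℝ 1 (u τ) := (hcl.contDiff_velocity hτ').of_le (by exact_mod_cast le_top)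
  have hcl' : HasWeakFDerivOn (⊤ : Opens (EuclideanSpace ℝ (Fin 3))) volume (u τ) (fderiv ℝ (u τ)) :=
    hasWeakGradient_fderiv_of_contDiff hC1
  have huniq := HasWeakFDerivOn.unique_holds hW hcl'
  rw [Opens.coe_top, Measure.restrict_univ] at huniq
  filter_upwards [huniq] with x hx
  rw [hx, (hasFDerivAt_slice hVd hbr hτ' x).fderiv]

/-! ### `E`-growth of the profile gradient at large scales -/

/-- **Ball integrals of `|∇V(d·)|²_F` — the dilation lower bound**: for `d > 0` and `L ≤ d a`,
`d^{−3} ∫_{B_L} |G|²_F ≤ ∫_{B_a} |G(d x)|²_F dx`. [folklore] -/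
theorem lintegral_ball_frobeniusNormSq_dilate_ge {d : ℝ} (hd : 0 < d)
    (G : EuclideanSpace ℝ (Fin 3) → EuclideanSpace ℝ (Fin 3) →L[ℝ] EuclideanSpace ℝ (Fin 3)) {a L : ℝ}
    (hLa : L ≤ d * a) :
    ENNReal.ofReal ((d ^ 3)⁻¹) * ∫⁻ y in ball (0 : EuclideanSpace ℝ (Fin 3)) L, ENNReal.ofReal (frobeniusNormSq (G y)) ≤
      ∫⁻ x in ball (0 : EuclideanSpace ℝ (Fin 3)) a, ENNReal.ofReal (frobeniusNormSq (G (d • x))) := by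
  rw [lintegral_ball_comp_smul (fun x => ENNReal.ofReal (frobeniusNormSq (G x))) hd a]
  exact mul_le_mul' le_rfl (lintegral_mono_set (ball_subset_ball hLa))

/-- **THE `E`-GAUGE OF A CLASSICAL BREATHER IN PROFILE VARIABLES (large scales).**  Let `H` be a.e.-strongly measurable on the
slab with `H(τ) = ∇V(e^{−cτ}·)` a.e. for a.e. `τ < 0` (output of `ae_slice_gradient_eq`) and `a^{ρ} E(a; 0; H) ≤ c₀` for all
`a > 0`.  Then `∫_{B_L} |∇V|²_F ≤ e^{6|c|} (e^{2|c|})^{1−ρ} c₀ · L^{1−ρ}` for every `L ≥ 2`: with `a = e^{2|c|} L` the window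
`(−2,−1) × B_a ⊆ Q_a(0,0)`, Tonelli, and on each window slice `e^{−6|c|}∫_{B_L}|∇V|²_F ≤ ∫_{B_a}|∇V(e^{−cτ}x)|²_F dx`
(`lintegral_ball_frobeniusNormSq_dilate_ge`, `e^{3cτ} ≥ e^{−6|c|}`, `e^{−cτ} a ≥ L`).  Template:
`Past.profile_gradient_growth_of_gaugeE_past`. [folklore] -/
theorem profile_gradient_growth_of_gaugeE {ρ : ℝ} {c₀ : ℝ≥0}
    (hHm : AEStronglyMeasurable (uncurry H)
      (volume.restrict (Iio (0 : ℝ) ×ˢ (univ : Set (EuclideanSpace ℝ (Fin 3))))))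
    (hHV : ∀ᵐ τ ∂((volume : Measure ℝ).restrict (Iio (0 : ℝ))),
      H τ =ᵐ[volume] fun x => fderiv ℝ V (Real.exp (-(c * τ)) • x))
    (hE : ∀ a : ℝ, 0 < a →
      ENNReal.ofReal (a ^ ρ) * cknE a (0 : ℝ × EuclideanSpace ℝ (Fin 3)) H ≤ (c₀ : ℝ≥0∞)) :
    ∀ L : ℝ, 2 ≤ L →
      ∫⁻ y in ball (0 : EuclideanSpace ℝ (Fin 3)) L, ENNReal.ofReal (frobeniusNormSq (fderiv ℝ V y)) ≤
        ENNReal.ofReal (Real.exp (6 * |c|) * Real.exp (2 * |c|) ^ (1 - ρ)) * (c₀ : ℝ≥0∞) *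
          ENNReal.ofReal (L ^ (1 - ρ)) := by
  -- adapted from `Past.profile_gradient_growth_of_gaugeE_past` (…SelfSimilarPastProfileDissipation)
  intro L hL
  set G : EuclideanSpace ℝ (Fin 3) → EuclideanSpace ℝ (Fin 3) →L[ℝ] EuclideanSpace ℝ (Fin 3) := fderiv ℝ V with hG
  have hfm : Measurable fun L : EuclideanSpace ℝ (Fin 3) →L[ℝ] EuclideanSpace ℝ (Fin 3) =>
      ENNReal.ofReal (frobeniusNormSq L) :=
    (SereginZajaczkowski2007.continuous_frobeniusNormSq).measurable.ennreal_ofReal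
  have hL0 : 0 < L := by linarith
  have he1 : 1 ≤ Real.exp (2 * |c|) := Real.one_le_exp (by positivity)
  -- ### the radius `a = e^{2|c|} L`
  set a : ℝ := Real.exp (2 * |c|) * L with ha
  have haL : L ≤ a := by rw [ha]; nlinarith
  have ha0 : 0 < a := by linarith
  have ha2 : (2 : ℝ) ≤ a ^ 2 := by nlinarith
  -- ### (1) the gauge: `X = ∫∫_{Q_a} |H|²_F ≤ a^{1−ρ} c₀`
  set X : ℝ≥0∞ := ∫⁻ q in parabolicCylinder a (0 : ℝ × EuclideanSpace ℝ (Fin 3)),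
    ENNReal.ofReal (frobeniusNormSq (H q.1 q.2)) with hX
  have hXle : X ≤ ENNReal.ofReal (a ^ (1 - ρ)) * (c₀ : ℝ≥0∞) := by
    have h1 := hE a ha0
    unfold cknE at h1
    have hB0 : ENNReal.ofReal (a ^ ρ) ≠ 0 := by
      rw [ENNReal.ofReal_ne_zero_iff]; exact Real.rpow_pos_of_pos ha0 _
    have hA0 : ENNReal.ofReal a ≠ 0 := by rw [ENNReal.ofReal_ne_zero_iff]; exact ha0
    have key : X = ENNReal.ofReal a * (ENNReal.ofReal (a ^ ρ))⁻¹ *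
        (ENNReal.ofReal (a ^ ρ) * ((ENNReal.ofReal a)⁻¹ * X)) := by
      rw [← mul_assoc, mul_assoc (ENNReal.ofReal a), ENNReal.inv_mul_cancel hB0 ENNReal.ofReal_ne_top,
        mul_one, ← mul_assoc, ENNReal.mul_inv_cancel hA0 ENNReal.ofReal_ne_top, one_mul]
    calc X = _ := key
      _ ≤ ENNReal.ofReal a * (ENNReal.ofReal (a ^ ρ))⁻¹ * (c₀ : ℝ≥0∞) := by gcongr
      _ = ENNReal.ofReal (a ^ (1 - ρ)) * (c₀ : ℝ≥0∞) := by
          rw [← ENNReal.ofReal_inv_of_pos (Real.rpow_pos_of_pos ha0 _), ← ENNReal.ofReal_mul ha0.le]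
          congr 2
          rw [Real.rpow_sub ha0, Real.rpow_one, div_eq_mul_inv]
  -- ### (2) the window `(−2, −1) × B_a` inside `Q_a(0,0)`
  have hWsub : Ioo (-2 : ℝ) (-1) ×ˢ ball (0 : EuclideanSpace ℝ (Fin 3)) a ⊆
      parabolicCylinder a (0 : ℝ × EuclideanSpace ℝ (Fin 3)) := by
    intro q hq
    rw [mem_prod, mem_Ioo, mem_ball] at hq
    rw [mem_parabolicCylinder, Prod.fst_zero, Prod.snd_zero, zero_sub]
    exact ⟨⟨by linarith [hq.1.1], by linarith [hq.1.2]⟩, hq.2⟩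
  have hY : ∫⁻ q in Ioo (-2 : ℝ) (-1) ×ˢ ball (0 : EuclideanSpace ℝ (Fin 3)) a,
      ENNReal.ofReal (frobeniusNormSq (H q.1 q.2)) ≤ X :=
    lintegral_mono_set hWsub
  -- ### (3) Tonelli on the window
  have hHmW : AEMeasurable (fun q : ℝ × EuclideanSpace ℝ (Fin 3) =>
      ENNReal.ofReal (frobeniusNormSq (H q.1 q.2)))
      (((volume : Measure ℝ).restrict (Ioo (-2 : ℝ) (-1))).prod
        ((volume : Measure (EuclideanSpace ℝ (Fin 3))).restrict (ball 0 a))) := by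
    have hsub : Ioo (-2 : ℝ) (-1) ×ˢ ball (0 : EuclideanSpace ℝ (Fin 3)) a ⊆
        Iio (0 : ℝ) ×ˢ (univ : Set (EuclideanSpace ℝ (Fin 3))) :=
      prod_mono (fun t ht => by have := ht.2; rw [mem_Iio]; linarith) (subset_univ _)
    have := hfm.comp_aemeasurable (hHm.mono_measure (Measure.restrict_mono hsub le_rfl)).aemeasurable
    rwa [Measure.volume_eq_prod, ← Measure.prod_restrict] at this
  have hYeq : ∫⁻ q in Ioo (-2 : ℝ) (-1) ×ˢ ball (0 : EuclideanSpace ℝ (Fin 3)) a,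
        ENNReal.ofReal (frobeniusNormSq (H q.1 q.2)) =
      ∫⁻ τ in Ioo (-2 : ℝ) (-1), ∫⁻ x in ball (0 : EuclideanSpace ℝ (Fin 3)) a,
        ENNReal.ofReal (frobeniusNormSq (H τ x)) := by
    rw [Measure.volume_eq_prod, ← Measure.prod_restrict, lintegral_prod _ hHmW]
  -- ### (4) the a.e. lower bound on the slices of the window
  set J : ℝ≥0∞ := ∫⁻ y in ball (0 : EuclideanSpace ℝ (Fin 3)) L, ENNReal.ofReal (frobeniusNormSq (G y)) with hJ
  have hWT : Ioo (-2 : ℝ) (-1) ⊆ Iio 0 := fun t ht => by have := ht.2; rw [mem_Iio]; linarith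
  have hlow : ∀ᵐ τ ∂((volume : Measure ℝ).restrict (Ioo (-2 : ℝ) (-1))),
      ENNReal.ofReal (Real.exp (-(6 * |c|))) * J ≤
        ∫⁻ x in ball (0 : EuclideanSpace ℝ (Fin 3)) a, ENNReal.ofReal (frobeniusNormSq (H τ x)) := by
    filter_upwards [ae_restrict_of_ae_restrict_of_subset hWT hHV, ae_restrict_mem measurableSet_Ioo]
      with τ hτ hτW
    have hcτ : |c * τ| ≤ 2 * |c| := by
      rw [abs_mul]
      have : |τ| ≤ 2 := by rw [abs_le]; constructor <;> linarith [hτW.1, hτW.2]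
      nlinarith [abs_nonneg c]
    set d : ℝ := Real.exp (-(c * τ)) with hd
    have hd0 : 0 < d := Real.exp_pos _
    -- replace `H τ` by the dilated classical gradient on the ball
    have hcongr : ∫⁻ x in ball (0 : EuclideanSpace ℝ (Fin 3)) a, ENNReal.ofReal (frobeniusNormSq (H τ x)) =
        ∫⁻ x in ball (0 : EuclideanSpace ℝ (Fin 3)) a, ENNReal.ofReal (frobeniusNormSq (G (d • x))) :=
      lintegral_congr_ae (ae_restrict_of_ae (hτ.mono fun x hx => by simp only [hx, hG, hd]))
    rw [hcongr]
    have hLa : L ≤ d * a := by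
      have h1 : Real.exp (-(2 * |c|)) ≤ d := by
        rw [hd, Real.exp_le_exp]; linarith [le_abs_self (c * τ), neg_abs_le (c * τ), hcτ]
      have h2 : Real.exp (-(2 * |c|)) * a = L := by
        rw [ha, ← mul_assoc, ← Real.exp_add, neg_add_cancel, Real.exp_zero, one_mul]
      rw [← h2]
      exact mul_le_mul_of_nonneg_right h1 ha0.le
    have hcoef : Real.exp (-(6 * |c|)) ≤ (d ^ 3)⁻¹ := by
      rw [hd, ← Real.exp_nat_mul, ← Real.exp_neg, Real.exp_le_exp]
      push_cast
      linarith [le_abs_self (c * τ), neg_abs_le (c * τ), hcτ]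
    calc ENNReal.ofReal (Real.exp (-(6 * |c|))) * J ≤ ENNReal.ofReal ((d ^ 3)⁻¹) * J :=
          mul_le_mul' (ENNReal.ofReal_le_ofReal hcoef) le_rfl
      _ ≤ _ := lintegral_ball_frobeniusNormSq_dilate_ge hd0 G hLa
  -- ### (5) integrate the lower bound over the window (length `1`)
  have hvolW : volume (Ioo (-2 : ℝ) (-1)) = 1 := by
    rw [Real.volume_Ioo, show (-1 : ℝ) - -2 = 1 by ring, ENNReal.ofReal_one]
  have hJle : ENNReal.ofReal (Real.exp (-(6 * |c|))) * J ≤ X :=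
    calc ENNReal.ofReal (Real.exp (-(6 * |c|))) * J
        = ∫⁻ _ in Ioo (-2 : ℝ) (-1), ENNReal.ofReal (Real.exp (-(6 * |c|))) * J := by
          rw [setLIntegral_const, hvolW, mul_one]
      _ ≤ ∫⁻ τ in Ioo (-2 : ℝ) (-1), ∫⁻ x in ball (0 : EuclideanSpace ℝ (Fin 3)) a,
            ENNReal.ofReal (frobeniusNormSq (H τ x)) := lintegral_mono_ae hlow
      _ = _ := hYeq.symm
      _ ≤ X := hY
  -- ### (6) assemble
  have haρ : a ^ (1 - ρ) = Real.exp (2 * |c|) ^ (1 - ρ) * L ^ (1 - ρ) := by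
    rw [ha, Real.mul_rpow (Real.exp_pos _).le hL0.le]
  have hunit : ENNReal.ofReal (Real.exp (6 * |c|)) * ENNReal.ofReal (Real.exp (-(6 * |c|))) = 1 := by
    rw [← ENNReal.ofReal_mul (Real.exp_pos _).le, ← Real.exp_add, add_neg_cancel, Real.exp_zero, ENNReal.ofReal_one]
  calc J = ENNReal.ofReal (Real.exp (6 * |c|)) * (ENNReal.ofReal (Real.exp (-(6 * |c|))) * J) := by
        rw [← mul_assoc, hunit, one_mul]
    _ ≤ ENNReal.ofReal (Real.exp (6 * |c|)) * X := by gcongr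
    _ ≤ ENNReal.ofReal (Real.exp (6 * |c|)) * (ENNReal.ofReal (a ^ (1 - ρ)) * (c₀ : ℝ≥0∞)) := by gcongr
    _ = ENNReal.ofReal (Real.exp (6 * |c|) * Real.exp (2 * |c|) ^ (1 - ρ)) * (c₀ : ℝ≥0∞) *
          ENNReal.ofReal (L ^ (1 - ρ)) := by
        rw [haρ, ENNReal.ofReal_mul (by positivity), ENNReal.ofReal_mul (by positivity)]
        ring

end BreatherRigidity

end Summit.NavierStokesRegularity.NavierStokesRegularity.Theorems.PowerGaugeEulerLiouville

end
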